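import Summits.Ventures.QEC.CircuitDistance.PortK2Sound
import Summits.Ventures.QEC.CircuitDistance.PortSectorFinal
import HarnessLib

/-!
# P3-PORT (K2): the BRIDGE from the K2 checker to the list-completeness binder (CARD-5 Theorem 2)
# (cell `qec`, experiment CDX, seat qec-cdx-type-1)

Generic over the sector: a syndrome matrix `H` (rows = checks `BB.Mono ℓ m`), a stabiliser matrix `Hs`, a class predicate
`IsCls` and a word list `words`.  A `K2Inst` packages the checker data `D : K2Data` (generators indexed `0 … N-1` in TYPE
blocks of `D.C = ℓm` positions), the class supports `gsupp` in that order, the logical supports `lsupp`, the per-cube stop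
lists `Ts`, live masks `lives` and stop witnesses `wit`.  `K2Inst.check` is the DECIDABLE consistency of all tables with
`H`, `lsupp`, translations and `words`; `k2_complete` turns `check = true`, the cube runs `D.cube … = true`, and the three
semantic facts (`H` and `rowSpace Hs` translation-covariant, every `H`-kernel vector outside `rowSpace Hs` is seen by some
logical support) into: every nontrivial class word of `≤ w` generators is a translate of a listed word.
-/

namespace Summit.Ventures.QEC.CircuitDistance

open Literature.InformationTheory.QuantumCodes Finset K2

variable {ℓ m : ℕ}

/-- `(n : ZMod 2) = 1 ↔ Odd n`. -/
theorem zmod2_natCast_eq_one_iff (n : ℕ) : (n : ZMod 2) = 1 ↔ Odd n := by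
  rw [← Nat.not_even_iff_odd, ← ZMod.natCast_eq_zero_iff_even]
  constructor
  · intro h h0; rw [h0] at h; exact absurd h (by decide)
  · intro h; rcases (by decide : ∀ a : ZMod 2, a = 0 ∨ a = 1) (n : ZMod 2) with h0 | h1
    · exact absurd h0 h
    · exact h1

/-- A sum of 0/1 values in `ZMod 2` is `1` iff an odd number of them are `1`. -/
theorem sum_eq_one_iff_odd {ι : Type*} (s : Finset ι) (f : ι → ZMod 2) :
    (∑ i ∈ s, f i) = 1 ↔ Odd (s.filter fun i => f i = 1).card := by
  classical
  have : (∑ i ∈ s, f i) = ∑ i ∈ s, (if f i = 1 then 1 else 0 : ZMod 2) := by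
    apply Finset.sum_congr rfl; intro i _
    rcases (by decide : ∀ a : ZMod 2, a = 0 ∨ a = 1) (f i) with h | h <;> simp [h]
  rw [this, ← Finset.sum_filter, Finset.sum_const, nsmul_eq_mul, mul_one, zmod2_natCast_eq_one_iff]

/-- DECIDABLE SEMANTICS of one syndrome bit: the parity of the generator support against row `j` of `H`. -/
def synSem (H : BB.Mono ℓ m → (BB.Mono ℓ m ⊕ BB.Mono ℓ m) → ZMod 2) (g : Finset (BB.Mono ℓ m ⊕ BB.Mono ℓ m))
    (j : BB.Mono ℓ m) : Bool :=
  decide (Odd (g.filter fun q => H j q = 1).card)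

/-- `synSem` computes `(H · indic g) j = 1`. -/
theorem synSem_iff [NeZero ℓ] [NeZero m] (H : Matrix (BB.Mono ℓ m) (BB.Mono ℓ m ⊕ BB.Mono ℓ m) (ZMod 2))
    (g : Finset (BB.Mono ℓ m ⊕ BB.Mono ℓ m)) (j : BB.Mono ℓ m) :
    synSem H g j = true ↔ (H.mulVec (indic g)) j = 1 := by
  unfold synSem
  rw [decide_eq_true_eq, Matrix.mulVec, dotProduct]
  have : (∑ q, H j q * indic g q) = ∑ q ∈ g, H j q := by
    unfold indic
    simp only [mul_ite, mul_one, mul_zero]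
    rw [← Finset.sum_filter]; congr 1; ext q; simp
  rw [this, sum_eq_one_iff_odd]

/-- DECIDABLE SEMANTICS of one logical bit: the parity of `g ∩ s`. -/
def lgSem (s g : Finset (BB.Mono ℓ m ⊕ BB.Mono ℓ m)) : Bool := decide (Odd (g.filter fun q => q ∈ s).card)

/-- `lgSem` computes `indic s ⬝ indic g = 1`. -/
theorem lgSem_iff [NeZero ℓ] [NeZero m] (s g : Finset (BB.Mono ℓ m ⊕ BB.Mono ℓ m)) :
    lgSem s g = true ↔ indic s ⬝ᵥ indic g = 1 := by
  unfold lgSem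
  rw [decide_eq_true_eq, dotProduct]
  have : (∑ q, indic s q * indic g q) = ∑ q ∈ g, indic s q := by
    unfold indic
    simp only [mul_ite, mul_one, mul_zero]
    rw [← Finset.sum_filter]; congr 1; ext q; simp
  rw [this, sum_eq_one_iff_odd]
  unfold indic
  constructor <;> intro h <;> convert h using 2 <;> ext q <;> simp

/-- K2 INSTANCE DATA for one sector. -/
structure K2Inst (ℓ m : ℕ) where
  /-- checker data -/
  D : K2Data
  /-- class supports, generator `n` ↦ `gsupp[n]`, in type blocks of `D.C` positions -/
  gsupp : List (Finset (BB.Mono ℓ m ⊕ BB.Mono ℓ m))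
  /-- logical supports (bit `j` of `lg`) -/
  lsupp : List (Finset (BB.Mono ℓ m ⊕ BB.Mono ℓ m))
  /-- stop lists, one per cube (= per pivot type) -/
  Ts : List (List ℕ)
  /-- live masks, one per cube -/
  lives : List ℕ
  /-- stop witnesses aligned with `Ts`: (index into `words`, translation) -/
  wit : List (List (ℕ × BB.Mono ℓ m))

namespace K2Inst

/-- Generator support by index (junk `∅` out of range). -/
def G (I : K2Inst ℓ m) (n : ℕ) : Finset (BB.Mono ℓ m ⊕ BB.Mono ℓ m) := I.gsupp.getD n ∅

variable [NeZero ℓ] [NeZero m]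

/-- THE DECIDABLE CONSISTENCY CHECK of the instance against `H`, the translations and the word list. -/
def check (I : K2Inst ℓ m) (H : BB.Mono ℓ m → (BB.Mono ℓ m ⊕ BB.Mono ℓ m) → ZMod 2)
    (words : List (List (Finset (BB.Mono ℓ m ⊕ BB.Mono ℓ m)))) : Bool :=
  let N := I.D.N
  let C := I.D.C
  let K := I.Ts.length
  decide (N = I.gsupp.length) && decide (N = K * C) && decide (I.lives.length = K) && decide (I.wit.length = K) &&
  decide (0 < C) && decide ((monoList ℓ m).length = C) && decide I.gsupp.Nodup && I.D.wfCheck && I.D.z0Check &&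
  -- syndrome table
  ((List.range N).all fun n => (List.range C).all fun c =>
    match (monoList ℓ m)[c]? with
    | none => false
    | some j => (I.D.synOf n).testBit c == synSem H (I.G n) j) &&
  -- logical table
  ((List.range N).all fun n => (List.range I.lsupp.length).all fun j =>
    (I.D.lgOf n).testBit j == lgSem (I.lsupp.getD j ∅) (I.G n)) &&
  -- live masks
  ((List.range K).all fun k => (List.range N).all fun n =>
    (I.lives.getD k 0).testBit n == (decide (C * k ≤ n) && !(n == C * k))) &&
  -- closure under the two generating translations, type preserved
  ([((1 : Fin ℓ), (0 : Fin m)), ((0 : Fin ℓ), (1 : Fin m))].all fun (t : BB.Mono ℓ m) => (List.range N).all fun n =>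
    (List.range N).any fun n' => decide (I.G n' = trQ t (I.G n)) && (n' / C == n / C)) &&
  -- every generator translates to the pivot (position 0) of its type
  ((List.range N).all fun n => (monoList ℓ m).any fun t => decide (trQ t (I.G n) = I.G (C * (n / C)))) &&
  -- stop witnesses
  ((List.range K).all fun k =>
    decide ((I.Ts.getD k []).length = (I.wit.getD k []).length) &&
    (List.range (I.Ts.getD k []).length).all fun i =>
      let msk := (I.Ts.getD k []).getD i 0
      let et := (I.wit.getD k []).getD i (0, 0)
      decide (et.1 < words.length) &&
      (((words.getD et.1 []).map (trQ et.2)).all fun g => decide (g ∈ I.gsupp)) &&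
      (List.range N).all fun n => msk.testBit n == decide (I.G n ∈ (words.getD et.1 []).map (trQ et.2)))


/-- The UNPACKED content of `check = true`. -/
structure Good (I : K2Inst ℓ m) (H : BB.Mono ℓ m → (BB.Mono ℓ m ⊕ BB.Mono ℓ m) → ZMod 2)
    (words : List (List (Finset (BB.Mono ℓ m ⊕ BB.Mono ℓ m)))) : Prop where
  /-- `N` generators listed -/
  hN : I.D.N = I.gsupp.length
  /-- `N = K·C` -/
  hNK : I.D.N = I.Ts.length * I.D.C
  /-- one live mask per cube -/
  hlives : I.lives.length = I.Ts.length
  /-- positions per type -/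
  hC : 0 < I.D.C
  /-- checks = `monoList` -/
  hmono : (monoList ℓ m).length = I.D.C
  /-- supports pairwise distinct -/
  nodup : I.gsupp.Nodup
  /-- checker data well formed -/
  wf : I.D.WF
  /-- `(Z0)` -/
  z0 : I.D.z0Check = true
  /-- syndrome table semantics -/
  syn : ∀ n < I.D.N, ∀ c (hc : c < (monoList ℓ m).length),
    (I.D.synOf n).testBit c = synSem H (I.G n) ((monoList ℓ m)[c])
  /-- logical table semantics -/
  lg : ∀ n < I.D.N, ∀ j < I.lsupp.length, (I.D.lgOf n).testBit j = lgSem (I.lsupp.getD j ∅) (I.G n)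
  /-- live masks = "type ≥ k and not the pivot" -/
  live : ∀ k < I.Ts.length, ∀ n < I.D.N,
    (I.lives.getD k 0).testBit n = (decide (I.D.C * k ≤ n) && !(n == I.D.C * k))
  /-- closure under the generating translations -/
  clos : ∀ t ∈ [((1 : Fin ℓ), (0 : Fin m)), ((0 : Fin ℓ), (1 : Fin m))], ∀ n < I.D.N,
    ∃ n' < I.D.N, I.G n' = trQ t (I.G n) ∧ n' / I.D.C = n / I.D.C
  /-- every generator translates to the pivot of its type -/
  piv : ∀ n < I.D.N, ∃ t : BB.Mono ℓ m, trQ t (I.G n) = I.G (I.D.C * (n / I.D.C))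
  /-- stop masks are index sets of translates of listed words -/
  wit_ok : ∀ k < I.Ts.length, ∀ msk ∈ I.Ts.getD k [], ∃ e < words.length, ∃ t : BB.Mono ℓ m,
    (∀ g ∈ (words.getD e []).map (trQ t), g ∈ I.gsupp) ∧
    ∀ n < I.D.N, msk.testBit n = decide (I.G n ∈ (words.getD e []).map (trQ t))

/-- `check = true` unpacks to `Good`. -/
theorem good_of_check (I : K2Inst ℓ m) (H : BB.Mono ℓ m → (BB.Mono ℓ m ⊕ BB.Mono ℓ m) → ZMod 2)
    (words : List (List (Finset (BB.Mono ℓ m ⊕ BB.Mono ℓ m)))) (h : I.check H words = true) : I.Good H words := by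
  unfold check at h
  simp only [Bool.and_eq_true, decide_eq_true_eq, List.all_eq_true, List.any_eq_true, List.mem_range, beq_iff_eq]
    at h
  obtain ⟨⟨⟨⟨⟨⟨⟨⟨⟨⟨⟨⟨⟨⟨hN, hNK⟩, hlives⟩, hwit⟩, hC⟩, hmono⟩, hnodup⟩, hwf⟩, hz0⟩, hsyn⟩, hlg⟩, hlive⟩, hclos⟩, hpiv⟩,
    hwitok⟩ := h
  refine ⟨hN, hNK, hlives, hC, hmono, hnodup, I.D.wf_of_check hwf, hz0, ?_, ?_, ?_, ?_, ?_, ?_⟩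
  · intro n hn c hc
    have := hsyn n hn c (by omega)
    rw [List.getElem?_eq_getElem hc] at this
    simpa using this
  · intro n hn j hj; exact hlg n hn j hj
  · intro k hk n hn; exact hlive k hk n hn
  · intro t ht n hn
    obtain ⟨n', hn', h1, h2⟩ := hclos t ht n hn
    exact ⟨n', hn', h1, h2⟩
  · intro n hn
    obtain ⟨t, _, ht⟩ := hpiv n hn
    exact ⟨t, ht⟩
  · intro k hk msk hmsk
    obtain ⟨hlen, hall⟩ := hwitok k hk
    obtain ⟨i, hi, rfl⟩ := List.mem_iff_getElem.1 hmsk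
    obtain ⟨⟨he, hg⟩, hb⟩ := hall i hi
    refine ⟨_, he, _, hg, fun n hn => ?_⟩
    rw [← hb n hn, List.getD_eq_getElem _ _ hi]


/-! ## Index words and their vectors -/

/-- The vector of an index word. -/
def vecOf (I : K2Inst ℓ m) (ix : Finset ℕ) : BB.Mono ℓ m ⊕ BB.Mono ℓ m → ZMod 2 := ∑ n ∈ ix, indic (I.G n)

/-- The index word of a class word. -/
def ixOf (I : K2Inst ℓ m) (x : Finset (Finset (BB.Mono ℓ m ⊕ BB.Mono ℓ m))) : Finset ℕ :=
  (Finset.range I.D.N).filter fun n => I.G n ∈ x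

variable {I : K2Inst ℓ m} {H : BB.Mono ℓ m → (BB.Mono ℓ m ⊕ BB.Mono ℓ m) → ZMod 2}
  {words : List (List (Finset (BB.Mono ℓ m ⊕ BB.Mono ℓ m)))}

omit [NeZero ℓ] [NeZero m] in
/-- Members of an index word are below `N`. -/
theorem mem_ixOf {x : Finset (Finset (BB.Mono ℓ m ⊕ BB.Mono ℓ m))} {n : ℕ} :
    n ∈ I.ixOf x ↔ n < I.D.N ∧ I.G n ∈ x := by
  unfold ixOf; rw [Finset.mem_filter, Finset.mem_range]

/-- `G` is injective below `N`. -/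
theorem G_inj (hg : I.Good H words) {n n' : ℕ} (hn : n < I.D.N) (hn' : n' < I.D.N) (h : I.G n = I.G n') : n = n' := by
  unfold G at h
  rw [hg.hN] at hn hn'
  rw [List.getD_eq_getElem _ _ hn, List.getD_eq_getElem _ _ hn'] at h
  exact (hg.nodup.getElem_inj_iff).1 h

/-- Every listed support has an index. -/
theorem exists_idx (hg : I.Good H words) {g : Finset (BB.Mono ℓ m ⊕ BB.Mono ℓ m)} (h : g ∈ I.gsupp) :
    ∃ n < I.D.N, I.G n = g := by
  obtain ⟨i, hi, rfl⟩ := List.mem_iff_getElem.1 h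
  exact ⟨i, hg.hN ▸ hi, by unfold G; rw [List.getD_eq_getElem _ _ hi]⟩

/-- The index word maps back onto the class word. -/
theorem image_G_ixOf (hg : I.Good H words) {x : Finset (Finset (BB.Mono ℓ m ⊕ BB.Mono ℓ m))}
    (hx : ∀ g ∈ x, g ∈ I.gsupp) : (I.ixOf x).image I.G = x := by
  ext g
  simp only [Finset.mem_image, mem_ixOf]
  constructor
  · rintro ⟨n, ⟨_, hn⟩, rfl⟩; exact hn
  · intro hgx
    obtain ⟨n, hn, rfl⟩ := exists_idx hg (hx g hgx)
    exact ⟨n, ⟨hn, hgx⟩, rfl⟩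

/-- `G` is injective on an index word. -/
theorem G_injOn (hg : I.Good H words) {ix : Finset ℕ} (hix : ∀ n ∈ ix, n < I.D.N) : Set.InjOn I.G ↑ix :=
  fun n hn n' hn' h => G_inj hg (hix n hn) (hix n' hn') h

/-- The index word has the cardinality of the class word. -/
theorem card_ixOf (hg : I.Good H words) {x : Finset (Finset (BB.Mono ℓ m ⊕ BB.Mono ℓ m))}
    (hx : ∀ g ∈ x, g ∈ I.gsupp) : (I.ixOf x).card = x.card := by
  conv_rhs => rw [← image_G_ixOf hg hx]
  rw [Finset.card_image_of_injOn (G_injOn hg fun n hn => (mem_ixOf.1 hn).1)]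

/-- The vector of a sub-index-word is the class-word sum of its image. -/
theorem vecOf_eq_sum_image (hg : I.Good H words) {ix : Finset ℕ} (hix : ∀ n ∈ ix, n < I.D.N) :
    I.vecOf ix = ∑ g ∈ ix.image I.G, indic g := by
  unfold vecOf; rw [Finset.sum_image (G_injOn hg hix)]

/-- The vector of the index word is the class-word vector. -/
theorem vecOf_ixOf (hg : I.Good H words) {x : Finset (Finset (BB.Mono ℓ m ⊕ BB.Mono ℓ m))}
    (hx : ∀ g ∈ x, g ∈ I.gsupp) : I.vecOf (I.ixOf x) = ∑ g ∈ x, indic g := by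
  rw [vecOf_eq_sum_image hg fun n hn => (mem_ixOf.1 hn).1, image_G_ixOf hg hx]

/-! ## Semantics of the parity bits -/

/-- Syndrome bit `c` of an index word = `(H · vec) (monoList[c]) = 1`. -/
theorem synBit_iff (hg : I.Good H words) {ix : Finset ℕ} (hix : ∀ n ∈ ix, n < I.D.N) (c : ℕ)
    (hc : c < (monoList ℓ m).length) :
    I.D.synBit ix c = true ↔ (Matrix.mulVec H (I.vecOf ix)) ((monoList ℓ m)[c]) = 1 := by
  unfold K2Data.synBit vecOf
  rw [decide_eq_true_eq, Matrix.mulVec_sum, Finset.sum_apply, sum_eq_one_iff_odd]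
  have : ix.filter (fun n => (I.D.synOf n).testBit c = true) =
      ix.filter (fun n => Matrix.mulVec H (indic (I.G n)) ((monoList ℓ m)[c]) = 1) := by
    apply Finset.filter_congr
    intro n hn
    rw [hg.syn n (hix n hn) c hc, synSem_iff]
  rw [this]

/-- Logical bit `j` of an index word = `indic lsupp[j] ⬝ vec = 1`. -/
theorem lgBit_iff (hg : I.Good H words) {ix : Finset ℕ} (hix : ∀ n ∈ ix, n < I.D.N) (j : ℕ)
    (hj : j < I.lsupp.length) :
    I.D.lgBit ix j = true ↔ indic (I.lsupp.getD j ∅) ⬝ᵥ I.vecOf ix = 1 := by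
  unfold K2Data.lgBit vecOf
  rw [decide_eq_true_eq, dotProduct_sum, sum_eq_one_iff_odd]
  have : ix.filter (fun n => (I.D.lgOf n).testBit j = true) =
      ix.filter (fun n => indic (I.lsupp.getD j ∅) ⬝ᵥ indic (I.G n) = 1) := by
    apply Finset.filter_congr
    intro n hn
    rw [hg.lg n (hix n hn) j hj, lgSem_iff]
  rw [this]

/-- Zero syndrome of the index word = the vector is in `ker H`. -/
theorem zeroSyn_iff (hg : I.Good H words) {ix : Finset ℕ} (hix : ∀ n ∈ ix, n < I.D.N) :
    I.D.ZeroSyn ix ↔ Matrix.mulVec H (I.vecOf ix) = 0 := by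
  constructor
  · intro hz
    funext j
    obtain ⟨c, hc, hcj⟩ := List.mem_iff_getElem.1 (mem_monoList j)
    have h1 := hz c
    have : ¬ (Matrix.mulVec H (I.vecOf ix)) ((monoList ℓ m)[c]) = 1 := by
      rw [← synBit_iff hg hix c hc, h1]; exact Bool.false_ne_true
    rw [hcj] at this
    rcases (by decide : ∀ a : ZMod 2, a = 0 ∨ a = 1) ((Matrix.mulVec H (I.vecOf ix)) j) with h0 | h0
    · exact h0
    · exact absurd h0 this
  · intro hz c
    by_cases hc : c < (monoList ℓ m).length
    · have : ¬ I.D.synBit ix c = true := by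
        rw [synBit_iff hg hix c hc, hz]; simp
      simpa using this
    · unfold K2Data.synBit
      rw [decide_eq_false_iff_not]
      have : ix.filter (fun n => (I.D.synOf n).testBit c = true) = ∅ := by
        apply Finset.filter_eq_empty_iff.2
        intro n hn
        have hlt : I.D.synOf n < 2 ^ c :=
          lt_of_lt_of_le (hg.wf.1 n (hix n hn)) (Nat.pow_le_pow_right (by norm_num) (by rw [← hg.hmono]; omega))
        rw [Nat.testBit_lt_two_pow hlt]; exact Bool.false_ne_true
      rw [this]; simp

/-- A nontrivial vector has an odd logical parity. -/
theorem exists_lgBit (hg : I.Good H words) {Hs : Matrix (BB.Mono ℓ m) (BB.Mono ℓ m ⊕ BB.Mono ℓ m) (ZMod 2)}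
    (hlog : ∀ v, Matrix.mulVec H v = 0 → v ∉ rowSpace Hs → ∃ s ∈ I.lsupp, indic s ⬝ᵥ v ≠ 0)
    {ix : Finset ℕ} (hix : ∀ n ∈ ix, n < I.D.N) (hz : Matrix.mulVec H (I.vecOf ix) = 0)
    (hn : I.vecOf ix ∉ rowSpace Hs) : ∃ j, I.D.lgBit ix j = true := by
  obtain ⟨s, hs, hsv⟩ := hlog _ hz hn
  obtain ⟨j, hj, rfl⟩ := List.mem_iff_getElem.1 hs
  refine ⟨j, (lgBit_iff hg hix j hj).2 ?_⟩
  rw [List.getD_eq_getElem _ _ hj]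
  rcases (by decide : ∀ a : ZMod 2, a = 0 ∨ a = 1) (indic I.lsupp[j] ⬝ᵥ I.vecOf ix) with h0 | h0
  · exact absurd h0 hsv
  · exact h0

/-- A zero-syndrome index word with all logical parities even has its vector in the stabiliser row space. -/
theorem mem_rowSpace_of_lgZero (hg : I.Good H words) {Hs : Matrix (BB.Mono ℓ m) (BB.Mono ℓ m ⊕ BB.Mono ℓ m) (ZMod 2)}
    (hlog : ∀ v, Matrix.mulVec H v = 0 → v ∉ rowSpace Hs → ∃ s ∈ I.lsupp, indic s ⬝ᵥ v ≠ 0)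
    {ix : Finset ℕ} (hix : ∀ n ∈ ix, n < I.D.N) (hzs : I.D.ZeroSyn ix) (hl : ∀ j, I.D.lgBit ix j = false) :
    I.vecOf ix ∈ rowSpace Hs := by
  by_contra hn
  obtain ⟨j, hj⟩ := exists_lgBit hg hlog hix ((zeroSyn_iff hg hix).1 hzs) hn
  rw [hl j] at hj; exact Bool.false_ne_true hj


/-- Listed supports are listed. -/
theorem G_mem (hg : I.Good H words) {n : ℕ} (hn : n < I.D.N) : I.G n ∈ I.gsupp := by
  unfold G; rw [hg.hN] at hn; rw [List.getD_eq_getElem _ _ hn]; exact List.getElem_mem hn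

end K2Inst

end Summit.Ventures.QEC.CircuitDistance
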